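import Summits.BirchSwinnertonDyer.Rank1Residual.GaloisImage.KolyvaginStubVanishingRat
import Summits.BirchSwinnertonDyer.Rank1Residual.GaloisImage.KolyvaginLevelOneUnitCase
import HarnessLib

/-!
# The EXOTIC unit case at `3` WITHOUT the [S24] named facts: a level-one Kolyvagin certificate gives
# `Sel₃(E/ℚ) = 0` and `BSD(E, 3)` — n1011-p13's `KolyvaginLevelOneUnitCase` END theorems re-run
# over Mazur–Rubin Thm. 4.3.4 at `m = 1` instead of Sakamoto's Thm. 4.4 (1)–(2)
# (cell `b2b-bsdres`, team n1011, ROUTE-1 item R1-56 sub-item K6; row T-R1-56-K6, seat p09 GEN 6;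
# file 4 of the row; skeleton `cells/n1011/skel/T-R1-56-K6.md`)

HONEST FRAMING (cell `b2b-bsdres`, run/shared/lean/b2b/bsd-rank1-residual/, verbatim in every
file): the goal of the cell is to DELETE the COMBINATION-SHAPED residual classes of the
Birch–Swinnerton-Dyer formula for ALL analytic-rank `≤ 1` elliptic curves over `ℚ` — "full BSD
formula for every rank `≤ 1` curve in class `C`" assembled STRICTLY from published theorems — so
that the rank-`≤ 1` remainder becomes exactly the CONSTRUCTION-SHAPED classes, which are TYPED
(missing-input `Prop`s), NOT attempted. This is not "finishing BSD". Team n1011 (N10/N11, the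
additive block `X4 ∧ p = 3`): research route; no claim beyond the stated classes; the label X4 and
the mark of RESIDUAL-MAP §I N11 are UNCHANGED by this file; nothing is booked. Theorems only: no
definition, no named fact is minted. The END theorems here are CONDITIONAL on Gross–Zagier–Kolyvagin
(`hGZK`, a named fact of the tree), on the Poitou–Tate family and Tate's local Euler–Poincaré
characteristic (`hEP`, a named fact), and on a LEVEL-ONE CERTIFICATE (binder) — and on NOTHING from
[S24]: the two named facts `Sakamoto2024.kolyvaginSystems_freeRankOne_zmod_three_pow` (Thm. 4.4 (1))
and `Sakamoto2024.kolyvaginSystems_idealOfBasis_eq_fittingIdeal_zmod_three_pow` (Thm. 4.4 (2)) that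
n1011-p13's `KolyvaginLevelOneUnitCase` carried are GONE from this chain.

## What

n1011-p13's `KolyvaginLevelOneUnitCase` proves: level-one certificate (a Kolyvagin system
`κ ∈ KS₁(E[3], 𝓕̄_can, 𝒫(τ))` whose bottom class is not a `3`-Selmer class) ⟹
`#H¹_{𝓕̄_can}(ℚ, E[3]) = 3` ⟹ `Sel₃(E/ℚ) = 0` ⟹ (with `r_an = 0`, `3 ∤ #Ш_an`, GZK) `BSD(E, 3)`, the
first arrow "two lines over [S24] Thm. 4.4 (1) + (2)".  File 3 of this row
(`KolyvaginStubVanishingRat`) re-proves that arrow from Mazur–Rubin Thm. 4.3.4 / Rubin PCMI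
Thm. 2.8.4 at `m = 1` (a THEOREM — file 1 — whose prime choice is Sakamoto's Cor. 5.5 = n1011-p15's
T-C55K, itself a theorem) and the core rank `χ(𝓕̄_can) = 1` (n1011-p13 / p04, a theorem modulo
`hEP`).  This file re-runs p13's two remaining arrows VERBATIM on top of it:

* `natCard_selmerGroup_three_eq_one_of_levelOne_certificate_noS24` — `#Sel^{(3)}(E/ℚ) = 1`;
* `bsdp_three_of_levelOne_certificate_noS24` — `BSD(E, 3)` (p13's `3`-Selmer certificate consumer
  `Additive.X4RankZero.bsdp_three_of_card_selmerThree_eq_one`, Miller / Silverman X.4.2);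
* `exists_kolyvaginDatum_bsdp_three_of_levelOne_certificate_noS24` — `τ`, `η`, `D` discharged
  existentially (p13's pattern: `exists_rootsOfUnityFixer_cokerSubOne_equiv_zmod_three_of_surj`,
  n1011-p04's `FSComp.exists_eta_kolyvaginDatum_hasCanonicalComparison_frobeniusClassPrimes`).

Signatures = p13's MINUS `hS24`, `hS24₂`, `hunro` (the unramified-orthogonality of the family is
not used by the `m = 1` argument).  Binders kept (nothing hidden): `hGZK`; `[Finite E[3]]`; surj(3);
`r_an = 0`, `#Ш_an` a `3`-adic unit (`hq`, `hv`); the `τ`-datum; the Poitou–Tate family `inv` ×3;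
`hEP`; an admissible `S`; the Kolyvagin datum on `E[3]` (`D`, `η`, `hP`, `hT`, `hD`); the
CERTIFICATE `κ`, `hκ` — in print Kato's Kolyvagin system at level one + the explicit reciprocity law
at the ADDITIVE prime `3` + `L(E,1)/Ω` a `3`-adic unit + `E(ℚ₃)[3] = 0`, NONE of which is in the
tree for additive `p = 3`: the typed located gap of row T-a5x, UNCHANGED.  EXOTIC rows stay REDUCED,
none closed; nothing booked; no mark / label changed.

References: [Rubin2011] Thm. 2.8.4 (p. 25); [MazurRubin2004] Thm. 4.3.4 (p. 45); [Sakamoto2024]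
Cor. 5.5 (p. 929); [Miller2011LMS] §1, Def. 1.1; [SilvermanAEC2009] Thm. X.4.2.
-/

noncomputable section

open scoped Classical NumberField ContRepresentation
open Field NumberField IsDedekindDomain
open WeierstrassCurve Literature.NumberTheory.EllipticCurves Literature.NumberTheory.GaloisRepresentations
  Literature.NumberTheory.GaloisRepresentations.DiscreteGaloisModule Literature.NumberTheory.GaloisCohomology

namespace Summit.BirchSwinnertonDyer.Rank1Residual.GaloisImage

variable (W : WeierstrassCurve ℚ) [W.IsElliptic]

/-- **The level-one unit case for the `3`-Selmer group, WITHOUT the [S24] facts.**  If the bottom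
class `κ_∅` of some Kolyvagin system `κ ∈ KS₁(E[3], 𝓕̄_can, 𝒫(τ))` is NOT a `3`-Selmer class (the
LEVEL-ONE CERTIFICATE, a binder), then `#Sel^{(3)}(E/ℚ) = 1`: `κ_∅ ≠ 0`, so `#H¹_{𝓕̄_can} = 3`
(file 3, `natCard_selmerGroup_propagatedSelmerStructureOne_eq_three_of_apply_empty_ne_zero_noS24` —
Mazur–Rubin Thm. 4.3.4 at `m = 1` + core rank one), and `Sel^{(3)} = H¹_𝓚 ≤ H¹_{𝓕̄_can}`
(`kummerSelmerStructure_le_propagatedSelmerStructureOne`) misses `κ_∅`, so it is a proper subgroup of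
a group of order `3`.  Proof text = n1011-p13's `natCard_selmerGroup_three_eq_one_of_levelOne_certificate`
with the first step swapped.  Binders = p13's MINUS `hS24`, `hS24₂`, `hunro`.
[cite: Rubin2011, Thm. 2.8.4 (p. 25)] [cite: MazurRubin2004, Thm. 4.3.4 (p. 45)]
[cite: SilvermanAEC2009, Thm X.4.2(b)] -/
theorem natCard_selmerGroup_three_eq_one_of_levelOne_certificate_noS24
    [Finite (geomTorsion W ((3 : ℕ) : ℤ))]
    (h3 : W.HasSurjectiveModNGaloisRep ((3 : ℕ) : ℤ))
    (τ : absoluteGaloisGroup ℚ) (hτμ : τ ∈ rootsOfUnityFixer ℚ 3)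
    (hτq : Nonempty (cokerSubOne (W.torsionGaloisModule ((3 : ℕ) : ℤ)) τ ≃+ ZMod 3))
    (inv : LocalInvariants ℚ 3) (hperf : inv.IsPerfect) (hsum : inv.SumLocalTermEqZero)
    (hcompl : inv.SelmerComplement)
    (hEP : ∀ v : HeightOneSpectrum (𝓞 ℚ), localEulerPoincareCharacteristic (v.adicCompletion ℚ))
    (S : Finset (Place ℚ)) (hS : ∀ w : InfinitePlace ℚ, (Sum.inl w : Place ℚ) ∈ S)
    (h3S : ∀ v : HeightOneSpectrum (𝓞 ℚ), ((3 : ℕ) : 𝓞 ℚ) ∈ v.asIdeal → (Sum.inr v : Place ℚ) ∈ S)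
    (hbadS : ∀ v : HeightOneSpectrum (𝓞 ℚ), ¬ W.HasGoodReductionAt v → (Sum.inr v : Place ℚ) ∈ S)
    (D : KolyvaginDatum (W.torsionGaloisModule ((3 : ℕ) : ℤ)))
    (η : (q : HeightOneSpectrum (𝓞 ℚ)) → (ZMod (Ideal.absNorm q.asIdeal))ˣ)
    (hP : D.primes = frobeniusClassPrimes (W.torsionGaloisModule ((3 : ℕ) : ℤ))
      {v | (Sum.inr v : Place ℚ) ∈ S} τ 3)
    (hT : D.transverse = cyclotomicTransverse (W.torsionGaloisModule ((3 : ℕ) : ℤ)))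
    (hD : D.HasCanonicalComparison 3 η)
    (κ : D.kolyvaginSystems (propagatedSelmerStructureOne W 3))
    (hκ : κ.1 ∅ ∉ (W.kummerSelmerStructure ((3 : ℕ) : ℤ)).selmerGroup) :
    Nat.card (W.selmerGroup (3 : ℤ)) = 1 := by
  haveI : Fact (Nat.Prime 3) := ⟨Nat.prime_three⟩
  have hκ0 : κ.1 ∅ ≠ 0 := fun h => hκ (by rw [h]; exact zero_mem _)
  have hG3 : Nat.card (propagatedSelmerStructureOne W 3).selmerGroup = 3 :=
    natCard_selmerGroup_propagatedSelmerStructureOne_eq_three_of_apply_empty_ne_zero_noS24 W h3 τ hτμ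
      hτq inv hperf hsum hcompl hEP S hS h3S hbadS D η hP hT hD κ hκ0
  have hle : (W.kummerSelmerStructure ((3 : ℕ) : ℤ)).selmerGroup ≤
      (propagatedSelmerStructureOne W 3).selmerGroup := fun x hx =>
    (SelmerStructure.mem_selmerGroup_iff _ x).2 fun v =>
      KummerCondition.kummerSelmerStructure_le_propagatedSelmerStructureOne W 3 v
        ((SelmerStructure.mem_selmerGroup_iff _ x).1 hx v)
  have hmem : κ.1 ∅ ∈ (propagatedSelmerStructureOne W 3).selmerGroup :=
    ((KolyvaginDatum.mem_kolyvaginSystems_iff D _ κ.1).mp κ.2).apply_empty_mem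
  haveI : Finite (propagatedSelmerStructureOne W 3).selmerGroup :=
    Nat.finite_of_card_ne_zero (by rw [hG3]; norm_num)
  have hdvd : Nat.card (W.kummerSelmerStructure ((3 : ℕ) : ℤ)).selmerGroup ∣
      Nat.card (propagatedSelmerStructureOne W 3).selmerGroup := AddSubgroup.card_dvd_of_le hle
  rw [hG3] at hdvd
  rcases (Nat.dvd_prime Nat.prime_three).mp hdvd with h1 | h3'
  · rw [selmerGroup_eq_selmerGroup_kummerSelmerStructure]
    exact h1
  · exfalso
    have heq : (W.kummerSelmerStructure ((3 : ℕ) : ℤ)).selmerGroup =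
        (propagatedSelmerStructureOne W 3).selmerGroup :=
      AddSubgroup.eq_of_le_of_card_ge hle (by rw [hG3, h3'])
    exact hκ (by rw [heq]; exact hmem)

/-- **BSD(E, 3) from a level-one Kolyvagin certificate — the EXOTIC unit case, class-free, WITHOUT
the [S24] facts.**  For `E/ℚ` with `ρ̄_{E,3}` onto, analytic rank `0` and `3 ∤ #Ш(E)_an`: given
Gross–Zagier–Kolyvagin (`hGZK`, named fact), the Poitou–Tate family, Tate's local Euler–Poincaré
characteristic `hEP`, an admissible `S`, a Kolyvagin datum on `E[3]` for Sakamoto's primes `𝒫(τ)`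
with the cyclotomic transverse conditions and THE canonical comparison maps, and a LEVEL-ONE
CERTIFICATE — a Kolyvagin system `κ ∈ KS₁(E[3], 𝓕̄_can, 𝒫(τ))` whose bottom class is not a
`3`-Selmer class — `BSD(E, 3)` holds (previous theorem + n1011-p13's consumer
`Additive.X4RankZero.bsdp_three_of_card_selmerThree_eq_one`).  NO `3`-adic tower, NO image-(im),
NO reduction-type hypothesis; and now NO Kolyvagin-system structure theorem either: n1011-p13's
`bsdp_three_of_levelOne_certificate` with `hS24`, `hS24₂` (and `hunro`) DELETED.  What is NOT proved
here (binders, nothing hidden): `hGZK`, the PT family, `hEP`, and above all the CERTIFICATE (Kato's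
Kolyvagin system at level one with a `3`-unit bottom class: explicit reciprocity / DICT3 at an
additive prime, route R1-21/R1-24 — the located gap of row T-a5x, unchanged).  EXOTIC rows are
reduced to (F3)(PT)(EP) + the certificate; none is closed.  Nothing booked; no mark / label changed.
[cite: Rubin2011, Thm. 2.8.4 (p. 25)] [cite: MazurRubin2004, Thm. 4.3.4 (p. 45)]
[cite: Miller2011LMS, §1 and Def. 1.1] [cite: SilvermanAEC2009, Thm X.4.2(a)] -/
theorem bsdp_three_of_levelOne_certificate_noS24
    (hGZK : rank_eq_analyticRank_of_analyticRank_le_one)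
    [Finite (geomTorsion W ((3 : ℕ) : ℤ))]
    (h3 : W.HasSurjectiveModNGaloisRep ((3 : ℕ) : ℤ)) (hr : W.analyticRank = 0)
    {q : ℚ} (hq : shaAn W = (q : ℂ)) (hv : padicValRat 3 q = 0)
    (τ : absoluteGaloisGroup ℚ) (hτμ : τ ∈ rootsOfUnityFixer ℚ 3)
    (hτq : Nonempty (cokerSubOne (W.torsionGaloisModule ((3 : ℕ) : ℤ)) τ ≃+ ZMod 3))
    (inv : LocalInvariants ℚ 3) (hperf : inv.IsPerfect) (hsum : inv.SumLocalTermEqZero)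
    (hcompl : inv.SelmerComplement)
    (hEP : ∀ v : HeightOneSpectrum (𝓞 ℚ), localEulerPoincareCharacteristic (v.adicCompletion ℚ))
    (S : Finset (Place ℚ)) (hS : ∀ w : InfinitePlace ℚ, (Sum.inl w : Place ℚ) ∈ S)
    (h3S : ∀ v : HeightOneSpectrum (𝓞 ℚ), ((3 : ℕ) : 𝓞 ℚ) ∈ v.asIdeal → (Sum.inr v : Place ℚ) ∈ S)
    (hbadS : ∀ v : HeightOneSpectrum (𝓞 ℚ), ¬ W.HasGoodReductionAt v → (Sum.inr v : Place ℚ) ∈ S)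
    (D : KolyvaginDatum (W.torsionGaloisModule ((3 : ℕ) : ℤ)))
    (η : (q : HeightOneSpectrum (𝓞 ℚ)) → (ZMod (Ideal.absNorm q.asIdeal))ˣ)
    (hP : D.primes = frobeniusClassPrimes (W.torsionGaloisModule ((3 : ℕ) : ℤ))
      {v | (Sum.inr v : Place ℚ) ∈ S} τ 3)
    (hT : D.transverse = cyclotomicTransverse (W.torsionGaloisModule ((3 : ℕ) : ℤ)))
    (hD : D.HasCanonicalComparison 3 η)
    (κ : D.kolyvaginSystems (propagatedSelmerStructureOne W 3))
    (hκ : κ.1 ∅ ∉ (W.kummerSelmerStructure ((3 : ℕ) : ℤ)).selmerGroup) :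
    BSDp W 3 :=
  Additive.X4RankZero.bsdp_three_of_card_selmerThree_eq_one W hGZK hr hq hv
    (natCard_selmerGroup_three_eq_one_of_levelOne_certificate_noS24 W h3 τ hτμ hτq inv hperf hsum
      hcompl hEP S hS h3S hbadS D η hP hT hD κ hκ)

/-- **The EXOTIC unit case with everything constructible discharged, WITHOUT the [S24] facts**:
from surj(3), `r_an = 0`, `3 ∤ #Ш_an`, Gross–Zagier–Kolyvagin, the Poitou–Tate family, `hEP` and
an admissible `S`, THERE ARE `τ ∈ Γ_{ℚ(μ₃)}` (`E[3]/(τ−1) ≃ 𝔽₃`, from surj(3):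
`exists_rootsOfUnityFixer_cokerSubOne_equiv_zmod_three_of_surj`), primitive roots `η` and a Kolyvagin
datum `D` on `E[3]` for Sakamoto's primes `𝒫(τ)` (cyclotomic transverse conditions, THE canonical
comparison maps; n1011-p04's `FSComp.exists_eta_kolyvaginDatum_hasCanonicalComparison_frobeniusClassPrimes`)
such that ANY Kolyvagin system `κ ∈ KS₁(E[3], 𝓕̄_can, 𝒫(τ))` whose bottom class is not a
`3`-Selmer class certifies `BSD(E, 3)`.  n1011-p13's
`exists_kolyvaginDatum_bsdp_three_of_levelOne_certificate` with `hS24`, `hS24₂`, `hunro` DELETED.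
The certificate itself is NOT constructed; EXOTIC rows stay reduced, none closed; nothing booked.
[cite: Rubin2011, Thm. 2.8.4 (p. 25)] [cite: MazurRubin2004, Thm. 4.3.4 (p. 45) and Lemma 1.2.3]
[cite: Sakamoto2024, §2 (H.2) and §4 (pp. 921–925)] -/
theorem exists_kolyvaginDatum_bsdp_three_of_levelOne_certificate_noS24
    (hGZK : rank_eq_analyticRank_of_analyticRank_le_one)
    [Finite (geomTorsion W ((3 : ℕ) : ℤ))]
    (h3 : W.HasSurjectiveModNGaloisRep ((3 : ℕ) : ℤ)) (hr : W.analyticRank = 0)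
    {q : ℚ} (hq : shaAn W = (q : ℂ)) (hv : padicValRat 3 q = 0)
    (inv : LocalInvariants ℚ 3) (hperf : inv.IsPerfect) (hsum : inv.SumLocalTermEqZero)
    (hcompl : inv.SelmerComplement)
    (hEP : ∀ v : HeightOneSpectrum (𝓞 ℚ), localEulerPoincareCharacteristic (v.adicCompletion ℚ))
    (S : Finset (Place ℚ)) (hS : ∀ w : InfinitePlace ℚ, (Sum.inl w : Place ℚ) ∈ S)
    (h3S : ∀ v : HeightOneSpectrum (𝓞 ℚ), ((3 : ℕ) : 𝓞 ℚ) ∈ v.asIdeal → (Sum.inr v : Place ℚ) ∈ S)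
    (hbadS : ∀ v : HeightOneSpectrum (𝓞 ℚ), ¬ W.HasGoodReductionAt v → (Sum.inr v : Place ℚ) ∈ S) :
    ∃ (τ : absoluteGaloisGroup ℚ) (η : (q : HeightOneSpectrum (𝓞 ℚ)) → (ZMod (Ideal.absNorm q.asIdeal))ˣ)
      (D : KolyvaginDatum (W.torsionGaloisModule ((3 : ℕ) : ℤ))),
      τ ∈ rootsOfUnityFixer ℚ 3 ∧
      Nonempty (cokerSubOne (W.torsionGaloisModule ((3 : ℕ) : ℤ)) τ ≃+ ZMod 3) ∧
      D.primes = frobeniusClassPrimes (W.torsionGaloisModule ((3 : ℕ) : ℤ))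
        {v | (Sum.inr v : Place ℚ) ∈ S} τ 3 ∧
      D.transverse = cyclotomicTransverse (W.torsionGaloisModule ((3 : ℕ) : ℤ)) ∧
      D.HasCanonicalComparison 3 η ∧
      ∀ κ : D.kolyvaginSystems (propagatedSelmerStructureOne W 3),
        κ.1 ∅ ∉ (W.kummerSelmerStructure ((3 : ℕ) : ℤ)).selmerGroup → BSDp W 3 := by
  obtain ⟨τ, hτ, hτq⟩ := exists_rootsOfUnityFixer_cokerSubOne_equiv_zmod_three_of_surj W h3
  have hτμ : τ ∈ rootsOfUnityFixer ℚ 3 := hτ 3 (by norm_num)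
  obtain ⟨η, D, hP, hT, hD⟩ :=
    FSComp.exists_eta_kolyvaginDatum_hasCanonicalComparison_frobeniusClassPrimes
      (W.torsionGaloisModule ((3 : ℕ) : ℤ)) 3 {v | (Sum.inr v : Place ℚ) ∈ S} hτμ hτq
      (cyclotomicTransverse (W.torsionGaloisModule ((3 : ℕ) : ℤ)))
  exact ⟨τ, η, D, hτμ, hτq, hP, hT, hD, fun κ hκ =>
    bsdp_three_of_levelOne_certificate_noS24 W hGZK h3 hr hq hv τ hτμ hτq inv hperf hsum hcompl hEP S
      hS h3S hbadS D η hP hT hD κ hκ⟩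

end Summit.BirchSwinnertonDyer.Rank1Residual.GaloisImage

end
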